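import Mathlib
import Summits.Ventures.PercRepro2.CutFarBA3Theorem

/-!
# The marks `b` and `a₃` behind an unmarked cut vertex, III: the raw sorting identity and the far counts (blind cell
PercRepro2, p3 g3, 2026-08-25; `proofs/P3-BRIDGE.md` §11.9 (b))

The RAW SORTING IDENTITY `typedCount F z τ K₃ = (Σ_{24} cL · cH) · (inert)` over the `o`-copy and
the exact `a₃`-pattern (`typedCount_eq_cutFarBA3_raw`, from `K3_eq_cutFarBA3` and
`typedCount_mul_three`); the far counts are orbit-invariant (`far_swapBA12/13/23`) and the `w`-patterns
add up in pairs to `A = #{b ∈ C_w(c), a₃ ∉ C_x(c), C_y(c)}`, `B = #{b ∈ C_w(c), a₃ ∈ C_x(c) ∖ C_y(c)}`,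
`C = #{b ∈ C_w(c), a₃ ∈ C_x(c), C_y(c)}` (`far_sums_BA`).  Own work;
standard axioms.
-/

namespace Summit.Ventures.PercRepro2

open UnionCluster

namespace CovForm

namespace RootBridge

open OneTyped TypedA3 Untouched TypedFactor Separated

section Count

open Classical

variable {V : Type*} {E : Type*} [Fintype E] [DecidableEq E] {R : Type*} [Field R]
  [LinearOrder R] [IsStrictOrderedRing R]
variable (ends : E → Sym2 V) (o a₁ a₂ a₃ b c : V)

omit [LinearOrder R] [IsStrictOrderedRing R] in
/-- **The raw sorting identity**: `typedCount F z τ K₃ = (Σ_{24} cL · cH) · (inert count)`. -/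
theorem typedCount_eq_cutFarBA3_raw {VL VH : Set V} (F : Finset E) (z : Config E) (τ : E → ℕ)
    (h : CutFarBA3 ends o a₁ a₂ a₃ b c VL VH F z) :
    typedCount F z τ (K3 ends o a₁ a₂ a₃ b : Config E → Config E → Config E → R) =
      (      typedCount (sideF ends VL F) z τ (lKBA3 ends a₃ b c VL true false false false false false) *
          typedCount (sideF ends VH F) z τ (hKBA ends o a₁ a₂ c VH true false false false false false) +
      typedCount (sideF ends VL F) z τ (lKBA3 ends a₃ b c VL true false false true false false) *
          typedCount (sideF ends VH F) z τ (hKBA ends o a₁ a₂ c VH true false false true false false) +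
      typedCount (sideF ends VL F) z τ (lKBA3 ends a₃ b c VL true false false false true false) *
          typedCount (sideF ends VH F) z τ (hKBA ends o a₁ a₂ c VH true false false false true false) +
      typedCount (sideF ends VL F) z τ (lKBA3 ends a₃ b c VL true false false false false true) *
          typedCount (sideF ends VH F) z τ (hKBA ends o a₁ a₂ c VH true false false false false true) +
      typedCount (sideF ends VL F) z τ (lKBA3 ends a₃ b c VL true false false true true false) *
          typedCount (sideF ends VH F) z τ (hKBA ends o a₁ a₂ c VH true false false true true false) +
      typedCount (sideF ends VL F) z τ (lKBA3 ends a₃ b c VL true false false true false true) *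
          typedCount (sideF ends VH F) z τ (hKBA ends o a₁ a₂ c VH true false false true false true) +
      typedCount (sideF ends VL F) z τ (lKBA3 ends a₃ b c VL true false false false true true) *
          typedCount (sideF ends VH F) z τ (hKBA ends o a₁ a₂ c VH true false false false true true) +
      typedCount (sideF ends VL F) z τ (lKBA3 ends a₃ b c VL true false false true true true) *
          typedCount (sideF ends VH F) z τ (hKBA ends o a₁ a₂ c VH true false false true true true) +
      typedCount (sideF ends VL F) z τ (lKBA3 ends a₃ b c VL false true false false false false) *
          typedCount (sideF ends VH F) z τ (hKBA ends o a₁ a₂ c VH false true false false false false) +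
      typedCount (sideF ends VL F) z τ (lKBA3 ends a₃ b c VL false true false true false false) *
          typedCount (sideF ends VH F) z τ (hKBA ends o a₁ a₂ c VH false true false true false false) +
      typedCount (sideF ends VL F) z τ (lKBA3 ends a₃ b c VL false true false false true false) *
          typedCount (sideF ends VH F) z τ (hKBA ends o a₁ a₂ c VH false true false false true false) +
      typedCount (sideF ends VL F) z τ (lKBA3 ends a₃ b c VL false true false false false true) *
          typedCount (sideF ends VH F) z τ (hKBA ends o a₁ a₂ c VH false true false false false true) +
      typedCount (sideF ends VL F) z τ (lKBA3 ends a₃ b c VL false true false true true false) *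
          typedCount (sideF ends VH F) z τ (hKBA ends o a₁ a₂ c VH false true false true true false) +
      typedCount (sideF ends VL F) z τ (lKBA3 ends a₃ b c VL false true false true false true) *
          typedCount (sideF ends VH F) z τ (hKBA ends o a₁ a₂ c VH false true false true false true) +
      typedCount (sideF ends VL F) z τ (lKBA3 ends a₃ b c VL false true false false true true) *
          typedCount (sideF ends VH F) z τ (hKBA ends o a₁ a₂ c VH false true false false true true) +
      typedCount (sideF ends VL F) z τ (lKBA3 ends a₃ b c VL false true false true true true) *
          typedCount (sideF ends VH F) z τ (hKBA ends o a₁ a₂ c VH false true false true true true) +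
      typedCount (sideF ends VL F) z τ (lKBA3 ends a₃ b c VL false false true false false false) *
          typedCount (sideF ends VH F) z τ (hKBA ends o a₁ a₂ c VH false false true false false false) +
      typedCount (sideF ends VL F) z τ (lKBA3 ends a₃ b c VL false false true true false false) *
          typedCount (sideF ends VH F) z τ (hKBA ends o a₁ a₂ c VH false false true true false false) +
      typedCount (sideF ends VL F) z τ (lKBA3 ends a₃ b c VL false false true false true false) *
          typedCount (sideF ends VH F) z τ (hKBA ends o a₁ a₂ c VH false false true false true false) +
      typedCount (sideF ends VL F) z τ (lKBA3 ends a₃ b c VL false false true false false true) *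
          typedCount (sideF ends VH F) z τ (hKBA ends o a₁ a₂ c VH false false true false false true) +
      typedCount (sideF ends VL F) z τ (lKBA3 ends a₃ b c VL false false true true true false) *
          typedCount (sideF ends VH F) z τ (hKBA ends o a₁ a₂ c VH false false true true true false) +
      typedCount (sideF ends VL F) z τ (lKBA3 ends a₃ b c VL false false true true false true) *
          typedCount (sideF ends VH F) z τ (hKBA ends o a₁ a₂ c VH false false true true false true) +
      typedCount (sideF ends VL F) z τ (lKBA3 ends a₃ b c VL false false true false true true) *
          typedCount (sideF ends VH F) z τ (hKBA ends o a₁ a₂ c VH false false true false true true) +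
      typedCount (sideF ends VL F) z τ (lKBA3 ends a₃ b c VL false false true true true true) *
          typedCount (sideF ends VH F) z τ (hKBA ends o a₁ a₂ c VH false false true true true true)) *
        typedCount (F \ (sideF ends VL F ∪ sideF ends VH F)) z τ (fun _ _ _ => (1 : R)) := by
  set A := sideF ends VL F with hA
  set B := sideF ends VH F with hB
  set C := F \ (A ∪ B) with hC
  have hAF : A ⊆ F := Finset.filter_subset _ _
  have hBF : B ⊆ F := Finset.filter_subset _ _
  have hAB : Disjoint A B := by
    rw [Finset.disjoint_left]
    intro e heA heB
    simp only [hA, hB, sideF, Finset.mem_filter] at heA heB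
    exact h.noloop e heA.1 ⟨heA.2, heB.2⟩
  have hABF : A ∪ B ⊆ F := Finset.union_subset hAF hBF
  have hAC : Disjoint A C := Finset.disjoint_of_subset_left Finset.subset_union_left Finset.disjoint_sdiff
  have hBC : Disjoint B C := Finset.disjoint_of_subset_left Finset.subset_union_right Finset.disjoint_sdiff
  have hF : A ∪ B ∪ C = F := Finset.union_sdiff_of_subset hABF
  have hker : typedCount F z τ (K3 ends o a₁ a₂ a₃ b : Config E → Config E → Config E → R) =
      typedCount F z τ (fun x y w =>
        lKBA3 ends a₃ b c VL true false false false false false (restr A z x) (restr A z y) (restr A z w) *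
          hKBA ends o a₁ a₂ c VH true false false false false false (restr B z x) (restr B z y) (restr B z w) +
        lKBA3 ends a₃ b c VL true false false true false false (restr A z x) (restr A z y) (restr A z w) *
          hKBA ends o a₁ a₂ c VH true false false true false false (restr B z x) (restr B z y) (restr B z w) +
        lKBA3 ends a₃ b c VL true false false false true false (restr A z x) (restr A z y) (restr A z w) *
          hKBA ends o a₁ a₂ c VH true false false false true false (restr B z x) (restr B z y) (restr B z w) +
        lKBA3 ends a₃ b c VL true false false false false true (restr A z x) (restr A z y) (restr A z w) *
          hKBA ends o a₁ a₂ c VH true false false false false true (restr B z x) (restr B z y) (restr B z w) +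
        lKBA3 ends a₃ b c VL true false false true true false (restr A z x) (restr A z y) (restr A z w) *
          hKBA ends o a₁ a₂ c VH true false false true true false (restr B z x) (restr B z y) (restr B z w) +
        lKBA3 ends a₃ b c VL true false false true false true (restr A z x) (restr A z y) (restr A z w) *
          hKBA ends o a₁ a₂ c VH true false false true false true (restr B z x) (restr B z y) (restr B z w) +
        lKBA3 ends a₃ b c VL true false false false true true (restr A z x) (restr A z y) (restr A z w) *
          hKBA ends o a₁ a₂ c VH true false false false true true (restr B z x) (restr B z y) (restr B z w) +
        lKBA3 ends a₃ b c VL true false false true true true (restr A z x) (restr A z y) (restr A z w) *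
          hKBA ends o a₁ a₂ c VH true false false true true true (restr B z x) (restr B z y) (restr B z w) +
        lKBA3 ends a₃ b c VL false true false false false false (restr A z x) (restr A z y) (restr A z w) *
          hKBA ends o a₁ a₂ c VH false true false false false false (restr B z x) (restr B z y) (restr B z w) +
        lKBA3 ends a₃ b c VL false true false true false false (restr A z x) (restr A z y) (restr A z w) *
          hKBA ends o a₁ a₂ c VH false true false true false false (restr B z x) (restr B z y) (restr B z w) +
        lKBA3 ends a₃ b c VL false true false false true false (restr A z x) (restr A z y) (restr A z w) *
          hKBA ends o a₁ a₂ c VH false true false false true false (restr B z x) (restr B z y) (restr B z w) +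
        lKBA3 ends a₃ b c VL false true false false false true (restr A z x) (restr A z y) (restr A z w) *
          hKBA ends o a₁ a₂ c VH false true false false false true (restr B z x) (restr B z y) (restr B z w) +
        lKBA3 ends a₃ b c VL false true false true true false (restr A z x) (restr A z y) (restr A z w) *
          hKBA ends o a₁ a₂ c VH false true false true true false (restr B z x) (restr B z y) (restr B z w) +
        lKBA3 ends a₃ b c VL false true false true false true (restr A z x) (restr A z y) (restr A z w) *
          hKBA ends o a₁ a₂ c VH false true false true false true (restr B z x) (restr B z y) (restr B z w) +
        lKBA3 ends a₃ b c VL false true false false true true (restr A z x) (restr A z y) (restr A z w) *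
          hKBA ends o a₁ a₂ c VH false true false false true true (restr B z x) (restr B z y) (restr B z w) +
        lKBA3 ends a₃ b c VL false true false true true true (restr A z x) (restr A z y) (restr A z w) *
          hKBA ends o a₁ a₂ c VH false true false true true true (restr B z x) (restr B z y) (restr B z w) +
        lKBA3 ends a₃ b c VL false false true false false false (restr A z x) (restr A z y) (restr A z w) *
          hKBA ends o a₁ a₂ c VH false false true false false false (restr B z x) (restr B z y) (restr B z w) +
        lKBA3 ends a₃ b c VL false false true true false false (restr A z x) (restr A z y) (restr A z w) *
          hKBA ends o a₁ a₂ c VH false false true true false false (restr B z x) (restr B z y) (restr B z w) +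
        lKBA3 ends a₃ b c VL false false true false true false (restr A z x) (restr A z y) (restr A z w) *
          hKBA ends o a₁ a₂ c VH false false true false true false (restr B z x) (restr B z y) (restr B z w) +
        lKBA3 ends a₃ b c VL false false true false false true (restr A z x) (restr A z y) (restr A z w) *
          hKBA ends o a₁ a₂ c VH false false true false false true (restr B z x) (restr B z y) (restr B z w) +
        lKBA3 ends a₃ b c VL false false true true true false (restr A z x) (restr A z y) (restr A z w) *
          hKBA ends o a₁ a₂ c VH false false true true true false (restr B z x) (restr B z y) (restr B z w) +
        lKBA3 ends a₃ b c VL false false true true false true (restr A z x) (restr A z y) (restr A z w) *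
          hKBA ends o a₁ a₂ c VH false false true true false true (restr B z x) (restr B z y) (restr B z w) +
        lKBA3 ends a₃ b c VL false false true false true true (restr A z x) (restr A z y) (restr A z w) *
          hKBA ends o a₁ a₂ c VH false false true false true true (restr B z x) (restr B z y) (restr B z w) +
        lKBA3 ends a₃ b c VL false false true true true true (restr A z x) (restr A z y) (restr A z w) *
          hKBA ends o a₁ a₂ c VH false false true true true true (restr B z x) (restr B z y) (restr B z w)) := by
    refine typedCount_congr_on_support F z τ fun x y w hc _ => ?_
    exact K3_eq_cutFarBA3 ends o a₁ a₂ a₃ b c h (fun e he => (hc e he).1)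
      (fun e he => (hc e he).2.1) (fun e he => (hc e he).2.2)
  rw [hker, typedCount_add', typedCount_add', typedCount_add', typedCount_add', typedCount_add', typedCount_add', typedCount_add', typedCount_add', typedCount_add', typedCount_add', typedCount_add', typedCount_add', typedCount_add', typedCount_add', typedCount_add', typedCount_add', typedCount_add', typedCount_add', typedCount_add', typedCount_add', typedCount_add', typedCount_add', typedCount_add']
  have hm : ∀ ox oy ow sx sy sw : Bool, typedCount (A ∪ B ∪ C) z τ (fun x y w =>
      lKBA3 ends a₃ b c VL ox oy ow sx sy sw (restr A z x) (restr A z y) (restr A z w) *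
        hKBA ends o a₁ a₂ c VH ox oy ow sx sy sw (restr B z x) (restr B z y) (restr B z w)) =
      typedCount A z τ (lKBA3 ends a₃ b c VL ox oy ow sx sy sw) *
        typedCount B z τ (hKBA ends o a₁ a₂ c VH ox oy ow sx sy sw) *
        typedCount C z τ (fun _ _ _ => (1 : R)) := fun ox oy ow sx sy sw =>
    typedCount_mul_three A B C hAB hAC hBC z τ (lKBA3 ends a₃ b c VL ox oy ow sx sy sw)
      (hKBA ends o a₁ a₂ c VH ox oy ow sx sy sw : Config E → Config E → Config E → R)
  rw [hF] at hm
  rw [hm true false false false false false, hm true false false true false false, hm true false false false true false, hm true false false false false true, hm true false false true true false, hm true false false true false true, hm true false false false true true, hm true false false true true true, hm false true false false false false, hm false true false true false false, hm false true false false true false, hm false true false false false true, hm false true false true true false, hm false true false true false true, hm false true false false true true, hm false true false true true true, hm false false true false false false, hm false false true true false false, hm false false true false true false, hm false false true false false true, hm false false true true true false, hm false false true true false true, hm false false true false true true, hm false false true true true true]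
  ring

omit [LinearOrder R] [IsStrictOrderedRing R] in
/-- The far counts are invariant under swapping the first two copies of the pattern. -/
lemma far_swapBA12 (VL : Set V) (A : Finset E) (z : Config E) (τ : E → ℕ) (ox oy ow sx sy sw : Bool) :
    typedCount A z τ (lKBA3 ends a₃ b c VL ox oy ow sx sy sw : Config E → Config E → Config E → R) =
      typedCount A z τ (lKBA3 ends a₃ b c VL oy ox ow sy sx sw) := by
  rw [← typedCount_swap12 A z τ (lKBA3 ends a₃ b c VL oy ox ow sy sx sw)]
  exact typedCount_congr' _ _ _ _ _ fun x y w => by unfold lKBA3 exactBA; push_cast; ring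

omit [LinearOrder R] [IsStrictOrderedRing R] in
/-- The far counts are invariant under swapping the last two copies of the pattern. -/
lemma far_swapBA23 (VL : Set V) (A : Finset E) (z : Config E) (τ : E → ℕ)
    (hτ : ∀ e ∈ A, τ e = 1 ∨ τ e = 2) (ox oy ow sx sy sw : Bool) :
    typedCount A z τ (lKBA3 ends a₃ b c VL ox oy ow sx sy sw : Config E → Config E → Config E → R) =
      typedCount A z τ (lKBA3 ends a₃ b c VL ox ow oy sx sw sy) := by
  rw [← typedCount_swap23 A z τ hτ (lKBA3 ends a₃ b c VL ox ow oy sx sw sy)]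
  exact typedCount_congr' _ _ _ _ _ fun x y w => by unfold lKBA3 exactBA; push_cast; ring

omit [LinearOrder R] [IsStrictOrderedRing R] in
/-- The far counts are invariant under swapping the outer copies of the pattern. -/
lemma far_swapBA13 (VL : Set V) (A : Finset E) (z : Config E) (τ : E → ℕ)
    (hτ : ∀ e ∈ A, τ e = 1 ∨ τ e = 2) (ox oy ow sx sy sw : Bool) :
    typedCount A z τ (lKBA3 ends a₃ b c VL ox oy ow sx sy sw : Config E → Config E → Config E → R) =
      typedCount A z τ (lKBA3 ends a₃ b c VL ow oy ox sw sy sx) := by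
  rw [← typedCount_swap13 A z τ hτ (lKBA3 ends a₃ b c VL ow oy ox sw sy sx)]
  exact typedCount_congr' _ _ _ _ _ fun x y w => by unfold lKBA3 exactBA; push_cast; ring

/-- The far count `A = #{b ∈ C_w(c), a₃ ∉ C_x(c), a₃ ∉ C_y(c)}`. -/
noncomputable def farA (VL : Set V) (A : Finset E) (z : Config E) (τ : E → ℕ) : R :=
  typedCount A z τ (fun x y w => ((indBA (gBA ends c VL b w) * ((1 - indBA (gBA ends c VL a₃ x)) *
    (1 - indBA (gBA ends c VL a₃ y))) : ℤ) : R))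

/-- The far count `B = #{b ∈ C_w(c), a₃ ∈ C_x(c), a₃ ∉ C_y(c)}`. -/
noncomputable def farB (VL : Set V) (A : Finset E) (z : Config E) (τ : E → ℕ) : R :=
  typedCount A z τ (fun x y w => ((indBA (gBA ends c VL b w) * (indBA (gBA ends c VL a₃ x) *
    (1 - indBA (gBA ends c VL a₃ y))) : ℤ) : R))

/-- The far count `C = #{b ∈ C_w(c), a₃ ∈ C_x(c), a₃ ∈ C_y(c)}`. -/
noncomputable def farC (VL : Set V) (A : Finset E) (z : Config E) (τ : E → ℕ) : R :=
  typedCount A z τ (fun x y w => ((indBA (gBA ends c VL b w) * (indBA (gBA ends c VL a₃ x) *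
    indBA (gBA ends c VL a₃ y)) : ℤ) : R))

omit [Fintype E] [DecidableEq E] [LinearOrder R] [IsStrictOrderedRing R] in
/-- The two exact patterns with `a₃ ∉ C_x, C_y` sum to `(1 − g₃(x))(1 − g₃(y))`. -/
lemma exact_sum_A (gx gy gw : Bool) :
    exactBA false false false gx gy gw + exactBA false false true gx gy gw =
      (1 - indBA gx) * (1 - indBA gy) := by
  cases gx <;> cases gy <;> cases gw <;> simp [exactBA, indBA]

omit [Fintype E] [DecidableEq E] [LinearOrder R] [IsStrictOrderedRing R] in
/-- The two exact patterns with `a₃ ∈ C_x`, `∉ C_y` sum to `g₃(x)(1 − g₃(y))`. -/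
lemma exact_sum_B (gx gy gw : Bool) :
    exactBA true false false gx gy gw + exactBA true false true gx gy gw =
      indBA gx * (1 - indBA gy) := by
  cases gx <;> cases gy <;> cases gw <;> simp [exactBA, indBA]

omit [Fintype E] [DecidableEq E] [LinearOrder R] [IsStrictOrderedRing R] in
/-- The two exact patterns with `a₃ ∈ C_x, C_y` sum to `g₃(x) g₃(y)`. -/
lemma exact_sum_C (gx gy gw : Bool) :
    exactBA true true false gx gy gw + exactBA true true true gx gy gw = indBA gx * indBA gy := by
  cases gx <;> cases gy <;> cases gw <;> simp [exactBA, indBA]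

omit [LinearOrder R] [IsStrictOrderedRing R] in
/-- **The far sums** `A`, `B`, `C` as sums of two `w`-patterns each. -/
lemma far_sums_BA (VL : Set V) (A : Finset E) (z : Config E) (τ : E → ℕ) :
    (typedCount A z τ (lKBA3 ends a₃ b c VL false false true false false false : Config E → Config E → Config E → R) +
        typedCount A z τ (lKBA3 ends a₃ b c VL false false true false false true) =
      farA (R := R) ends a₃ b c VL A z τ) ∧
    (typedCount A z τ (lKBA3 ends a₃ b c VL false false true true false false : Config E → Config E → Config E → R) +
        typedCount A z τ (lKBA3 ends a₃ b c VL false false true true false true) =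
      farB (R := R) ends a₃ b c VL A z τ) ∧
    (typedCount A z τ (lKBA3 ends a₃ b c VL false false true true true false : Config E → Config E → Config E → R) +
        typedCount A z τ (lKBA3 ends a₃ b c VL false false true true true true) =
      farC (R := R) ends a₃ b c VL A z τ) := by
  refine ⟨?_, ?_, ?_⟩
  · rw [← typedCount_add']
    unfold farA
    refine typedCount_congr' _ _ _ _ _ fun x y w => ?_
    unfold lKBA3
    have e := exact_sum_A (gBA ends c VL a₃ x) (gBA ends c VL a₃ y) (gBA ends c VL a₃ w)
    have e' := congrArg (fun n : ℤ => (n : R)) e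
    push_cast at e' ⊢
    simp only [ofxBA_true, ofxBA_false]
    push_cast
    linear_combination ((indBA (gBA ends c VL b w) : ℤ) : R) * e'
  · rw [← typedCount_add']
    unfold farB
    refine typedCount_congr' _ _ _ _ _ fun x y w => ?_
    unfold lKBA3
    have e := exact_sum_B (gBA ends c VL a₃ x) (gBA ends c VL a₃ y) (gBA ends c VL a₃ w)
    have e' := congrArg (fun n : ℤ => (n : R)) e
    push_cast at e' ⊢
    simp only [ofxBA_true, ofxBA_false]
    push_cast
    linear_combination ((indBA (gBA ends c VL b w) : ℤ) : R) * e'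
  · rw [← typedCount_add']
    unfold farC
    refine typedCount_congr' _ _ _ _ _ fun x y w => ?_
    unfold lKBA3
    have e := exact_sum_C (gBA ends c VL a₃ x) (gBA ends c VL a₃ y) (gBA ends c VL a₃ w)
    have e' := congrArg (fun n : ℤ => (n : R)) e
    push_cast at e' ⊢
    simp only [ofxBA_true, ofxBA_false]
    push_cast
    linear_combination ((indBA (gBA ends c VL b w) : ℤ) : R) * e'

end Count

end RootBridge

end CovForm

end Summit.Ventures.PercRepro2
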